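import Summits.ValiantsHypothesis.ValiantsHypothesis.Theorems.GrenetZeonDualUnipotentThreeHalvesLongMassValueSpaceMono

/-!
# `GrenetZeon.DualUnipotentThreeHalves` (stmt-ValiantsHypothesis-24318), line `slow_core`, stub (c) `SlowCore.LongMassSlowLawInv`:
# MONOTONICITY OF THE (c)-PRICE FOR AFFINE PENCILS — point values and linear parts

✓ `relCert_of_valueSpace_le` (`…LongMassValueSpaceMono`) is stated for LINEAR pencils.  The census rows of the cell are often AFFINE (e.g. the
gauge row ✓ `relCert_gaugePencil : RelCert n m (gaugePencil ℓ Ĉ) (2n+1)` with affine `ℓ`, `Ĉ`).  This file gives the AFFINE form, with the same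
proof: ★★★ `relCert_of_affineValues_le` — if every POINT VALUE of `N` is a point value of `N₁` (`∀ x ∃ x₁, N(x) = N₁(x₁)`) and every LINEAR
PART of `N` is a linear part of `N₁` (`∀ v ∃ v₁, lin_N v = lin_{N₁} v₁`), then every certificate price of `N₁` is a certificate price of `N`
(`RelCert n b N₁ P → RelCert n b N P`, no loss; both pencils affine over the same `n²` coordinates, otherwise unrelated).  So every priced ROW
of (c) extends BY NAME to all affine pencils whose point values and linear parts lie inside the row's (sub-pencils, re-parametrisations,
specialisations of coordinates), e.g. to every affine sub-family of the gauge family.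

Proof.  The line of an affine pencil is `N(x + s v) = N(x) + s · lin_N v` (✓ `SlowCore.lineSubst_apply_of_le_one`); take `K := T⁻¹(T₁ K₁)`
for the linear-part maps `T, T₁` (✓ `LedgerIndex.exists_linearMap_linMat`); the price count is ✓ `codim_comap_map_le_of_range_le`.

Honest framing.  A monotonicity lemma (`--supports stmt-ValiantsHypothesis-24318`), NOT progress on (c): (c) `SlowCore.LongMassSlowLawInv`, S3,
the crux 24318, 8062 and `VP ≠ VNP` remain OPEN / NOT proved.  No sorry, no definitions, no named facts.
-/

-- single-conjunct layout: Sub = Summit, duplicated namespace component intended (the name is mandated)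
set_option linter.dupNamespace false
set_option autoImplicit false

noncomputable section

namespace Summit.ValiantsHypothesis.ValiantsHypothesis.Theorems.GrenetZeon.LongMassHomogenise

open MvPolynomial Matrix
open scoped BigOperators
open Summit.ValiantsHypothesis.ValiantsHypothesis.Cruxes.TwoDimCoefficients.DimTwoCases (AffMat IsAffine)
open Summit.ValiantsHypothesis.ValiantsHypothesis.Theorems.GrenetZeon.RadicalSplit (lineSubst)
open Summit.ValiantsHypothesis.ValiantsHypothesis.Theorems.GrenetZeon.SlowCore
open Summit.ValiantsHypothesis.ValiantsHypothesis.Theorems.GrenetZeon.ResolventFlag (linMat)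
open Summit.ValiantsHypothesis.ValiantsHypothesis.Theorems.GrenetZeon.LedgerIndex (exists_linearMap_linMat)

variable {n b : ℕ}

/-- The pulled-back line of an AFFINE pencil depends only on the point value `N(x)` and the linear part `lin_N v`. -/
theorem map_lineSubst_eq_of_eval_eq_of_linMat_eq (N N₁ : AffMat n b) (hN : IsAffine N) (hN₁ : IsAffine N₁)
    {x v x₁ v₁ : Fin n × Fin n → ℂ} (hx : N.map (eval x) = N₁.map (eval x₁)) (hv : linMat N v = linMat N₁ v₁) :
    N.map (lineSubst x v) = N₁.map (lineSubst x₁ v₁) := by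
  ext i j : 2
  simp only [Matrix.map_apply]
  have hx' : eval x (N i j) = eval x₁ (N₁ i j) := by
    have := congr_fun (congr_fun hx i) j
    simpa [Matrix.map_apply] using this
  have hv' : linEntry N i j v = linEntry N₁ i j v₁ := by
    have := congr_fun (congr_fun hv i) j
    simpa [linMat] using this
  rw [lineSubst_apply_of_le_one N hN, lineSubst_apply_of_le_one N₁ hN₁, hx', hv']

/-- ★★★ **MONOTONICITY OF THE (c)-PRICE, AFFINE FORM.**  If every point value of `N` is a point value of `N₁` and every linear part of `N` is a
linear part of `N₁`, then every certificate price of `N₁` is a certificate price of `N`. -/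
theorem relCert_of_affineValues_le (N N₁ : AffMat n b) (hN : IsAffine N) (hN₁ : IsAffine N₁)
    (hpt : ∀ x, ∃ x₁, N.map (eval x) = N₁.map (eval x₁)) (hle : ∀ v, ∃ v₁, linMat N v = linMat N₁ v₁)
    {P : ℕ} (h : RelCert n b N₁ P) : RelCert n b N P := by
  obtain ⟨T, hT⟩ := exists_linearMap_linMat N
  obtain ⟨T₁, hT₁⟩ := exists_linearMap_linMat N₁
  have hrange : LinearMap.range T ≤ LinearMap.range T₁ := by
    rintro _ ⟨v, rfl⟩
    obtain ⟨v₁, hv₁⟩ := hle v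
    exact ⟨v₁, by rw [hT₁, ← hv₁, hT]⟩
  obtain ⟨K₁, k, hK₁, hprice⟩ := h
  refine ⟨(K₁.map T₁).comap T, k, ?_, ?_⟩
  · intro x v hv p hp i j _ _
    obtain ⟨x₁, hx₁⟩ := hpt x
    obtain ⟨v₁, hv₁K, hv₁⟩ := Submodule.mem_map.mp (Submodule.mem_comap.mp hv)
    have hv' : linMat N v = linMat N₁ v₁ := by rw [← hT, ← hT₁, hv₁]
    rw [map_lineSubst_eq_of_eval_eq_of_linMat_eq N N₁ hN hN₁ hx₁ hv']
    exact hK₁ x₁ v₁ hv₁K p hp i j trivial trivial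
  · exact le_trans (Nat.add_le_add_left (codim_comap_map_le_of_range_le T T₁ hrange K₁) _) hprice

/-- ★★ Two affine pencils with the same point values and the same linear parts have the same certificate prices. -/
theorem relCert_iff_of_affineValues_eq (N N₁ : AffMat n b) (hN : IsAffine N) (hN₁ : IsAffine N₁)
    (hpt : ∀ x, ∃ x₁, N.map (eval x) = N₁.map (eval x₁)) (hpt' : ∀ x₁, ∃ x, N₁.map (eval x₁) = N.map (eval x))
    (hle : ∀ v, ∃ v₁, linMat N v = linMat N₁ v₁) (hge : ∀ v₁, ∃ v, linMat N₁ v₁ = linMat N v) (P : ℕ) :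
    RelCert n b N P ↔ RelCert n b N₁ P :=
  ⟨fun h => relCert_of_affineValues_le N₁ N hN₁ hN hpt' hge h, fun h => relCert_of_affineValues_le N N₁ hN hN₁ hpt hle h⟩

end Summit.ValiantsHypothesis.ValiantsHypothesis.Theorems.GrenetZeon.LongMassHomogenise

end
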